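import Summits.Schanuel.Schanuel.Theses.RoyCriterion
import Literature.NumberTheory.Transcendental.RankOneGridTrdeg
import Literature.NumberTheory.Transcendental.LindemannWeierstrassProofs
import Literature.NumberTheory.Transcendental.KirbyWeakSchanuelAx
import Summits.Schanuel.Schanuel.Theorems.RoyCriterionRankOne

/-!
# Rank structure of Roy's criterion (negative-side structure for crux `stmt-Schanuel-0463`)

Crux `Summit.Schanuel.Schanuel.Theses.RoyCriterion.RoyThesisTyped = ∀ n, RoyCriterion n` (Roy 2001,
Acta Arith. 97, §1, Conjecture 2 for every rank; equivalent rank by rank to Schanuel's conjecture by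
the tree theorem `Roy2001_iff_holds`). This file proves, without named facts and without defs, the
structure of the set of COUNTEREXAMPLE RANKS and the shape of a first counterexample:

* `RoyThesisTyped.exists_isIntegral_not_mem_span` — algebraic integers escape every
  finite-dimensional `ℚ`-subspace of `ℂ` (powers of a primitive `p`-th root of unity, `p ≥ l + 2`
  prime, are `ℚ`-free: Mathlib `cyclotomic_eq_minpoly_rat` + `linearIndependent_pow`).
* `RoyThesisTyped.schanuelRank_of_succ : SchanuelRank (l + 1) → SchanuelRank l` — extend a
  `ℚ`-free `y` by such a `c`; `trdeg ℚ(y, c, e^y, e^c) ≤ trdeg ℚ(y, e^y) + 1`. Hence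
  `schanuelRank_anti`, `royCriterion_anti` (antitone in the rank) and
  **`not_royCriterion_of_le`: counterexample ranks form an up-set**.
* `RoyThesisTyped.crux_iff_frequently`, `RoyThesisTyped.crux_iff_eventually` — the crux is
  equivalent to "Roy's criterion for infinitely many ranks" and to "for all large ranks": neither is
  a weakening; no rank can be skipped.
* `RoyThesisTyped.schanuelRank_of_isAlgebraic` (Lindemann–Weierstrass layer, tree theorem
  `algebraicIndependent_exp_holds`) and `RoyThesisTyped.exists_transcendental_of_counterexample`:
  a counterexample tuple has a transcendental coordinate.
* `RoyThesisTyped.trdeg_eq_of_first_failure` — at the first failing rank `l + 1` the defect is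
  exactly one: `trdeg ℚ(y, e^y) = l`.
* `RoyThesisTyped.crux_iff_reduced` — THE REDUCED CRUX: with Kirby 2010 Prop. 7.2 (tree theorem
  `schanuelConjecture_iff_ecl_empty_holds`), ranks `0, 1` (tree) and the Lindemann–Weierstrass
  layer, the crux is equivalent to Schanuel's inequality for `ℚ`-free tuples of rank `≥ 2` drawn
  from `ecl ∅` with at least one transcendental coordinate — what a disproof must violate and a
  proof may assume.

Everything is proved from Mathlib and the tree; no defs, no sorries.
-/

set_option linter.dupNamespace false

noncomputable section

namespace Summit.Schanuel.Schanuel.Theorems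

open Filter Complex
open Literature.NumberTheory.Transcendental

/-- **Algebraic numbers escape every finite-dimensional `ℚ`-subspace of `ℂ`**: for `y : Fin l → ℂ`
there is an algebraic integer `c ∉ span_ℚ(y)` — a power `ζ^i` of a primitive `p`-th root of unity
with `p ≥ l + 2` prime (the `p − 1` powers `ζ^i`, `i < p − 1`, are `ℚ`-linearly independent by the
irreducibility of the cyclotomic polynomial). [folklore] -/
theorem RoyThesisTyped.exists_isIntegral_not_mem_span {l : ℕ} (y : Fin l → ℂ) :
    ∃ c : ℂ, IsIntegral ℚ c ∧ c ∉ Submodule.span ℚ (Set.range y) := by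
  obtain ⟨p, hp, hprime⟩ := Nat.exists_infinite_primes (l + 2)
  have hp0 : p ≠ 0 := hprime.ne_zero
  set ζ : ℂ := cexp (2 * Real.pi * I / p) with hζ
  have hprim : IsPrimitiveRoot ζ p := Complex.isPrimitiveRoot_exp p hp0
  have hint : IsIntegral ℚ ζ := (hprim.isIntegral hprime.pos).tower_top
  have hdeg : (minpoly ℚ ζ).natDegree = p - 1 := by
    rw [← Polynomial.cyclotomic_eq_minpoly_rat hprim hprime.pos, Polynomial.natDegree_cyclotomic,
      Nat.totient_prime hprime]
  have hli := linearIndependent_pow (K := ℚ) ζ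
  by_contra hall
  set W : Submodule ℚ ℂ := Submodule.span ℚ (Set.range y) with hW
  have hall' : ∀ c : ℂ, IsIntegral ℚ c → c ∈ W := fun c hc' =>
    not_not.mp fun hn => hall ⟨c, hc', hn⟩
  have hmem : ∀ i : Fin (minpoly ℚ ζ).natDegree, ζ ^ (i : ℕ) ∈ W := fun i => hall' _ (hint.pow _)
  let g : Fin (minpoly ℚ ζ).natDegree → W := fun i => ⟨ζ ^ (i : ℕ), hmem i⟩
  have hg : LinearIndependent ℚ g := LinearIndependent.of_comp W.subtype hli
  haveI : Module.Finite ℚ W := FiniteDimensional.span_of_finite ℚ (Set.finite_range y)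
  have hcard := hg.fintype_card_le_finrank
  have hWl : Module.finrank ℚ W ≤ l := by
    have := finrank_range_le_card (R := ℚ) y
    simpa [Set.finrank] using this
  rw [Fintype.card_fin, hdeg] at hcard
  omega

/-- **Schanuel ranks are downward hereditary** (equivalently: COUNTEREXAMPLE RANKS FORM AN UP-SET):
`SchanuelRank (l + 1) → SchanuelRank l`. Given `y` linearly independent of rank `l`, extend it by an
algebraic `c ∉ span_ℚ(y)` (`exists_isIntegral_not_mem_span`); then
`trdeg ℚ(y, c, e^y, e^c) ≤ trdeg ℚ(y, e^y) + 1` (`c` costs nothing, `e^c` at most one), so rank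
`l + 1` for the extended tuple gives rank `l` for `y`. [folklore] -/
theorem RoyThesisTyped.schanuelRank_of_succ {l : ℕ} (h : SchanuelRank (l + 1)) : SchanuelRank l := by
  intro y hy
  obtain ⟨c, hc, hcW⟩ := RoyThesisTyped.exists_isIntegral_not_mem_span y
  have hy' : LinearIndependent ℚ (Fin.cons c y : Fin (l + 1) → ℂ) :=
    linearIndependent_finCons.mpr ⟨hy, hcW⟩
  have h1 := h (Fin.cons c y) hy'
  set S : Set ℂ := Set.range y ∪ Set.range (cexp ∘ y) with hS
  have hle : IntermediateField.adjoin ℚ (Set.range (Fin.cons c y : Fin (l + 1) → ℂ) ∪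
      Set.range (cexp ∘ (Fin.cons c y : Fin (l + 1) → ℂ))) ≤
      IntermediateField.adjoin ℚ ((S ∪ {cexp c}) ∪ {c}) := by
    apply IntermediateField.adjoin.mono
    rintro x (⟨i, rfl⟩ | ⟨i, rfl⟩)
    · refine Fin.cases ?_ (fun j => ?_) i
      · simp
      · simp [hS]
    · refine Fin.cases ?_ (fun j => ?_) i
      · simp
      · simp [hS]
  have halg : ∀ x ∈ ({c} : Set ℂ), IsAlgebraic ℚ x := by
    rintro x rfl
    exact hc.isAlgebraic
  have hone : Algebra.trdeg ℚ ↥(IntermediateField.adjoin ℚ ({cexp c} : Set ℂ)) ≤ 1 := by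
    have := trdeg_adjoin_le_mk (F := ℚ) ({cexp c} : Set ℂ)
    rwa [Cardinal.mk_singleton] at this
  have key : Algebra.trdeg ℚ ↥(IntermediateField.adjoin ℚ ((S ∪ {cexp c}) ∪ {c})) ≤
      Algebra.trdeg ℚ ↥(IntermediateField.adjoin ℚ S) + 1 := by
    calc Algebra.trdeg ℚ ↥(IntermediateField.adjoin ℚ ((S ∪ {cexp c}) ∪ {c}))
        = Algebra.trdeg ℚ ↥(IntermediateField.adjoin ℚ (S ∪ {cexp c})) :=
          Literature.Barriers.Schanuel.trdeg_adjoin_union_eq_of_isAlgebraic (S ∪ {cexp c}) {c} halg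
      _ ≤ Algebra.trdeg ℚ ↥(IntermediateField.adjoin ℚ S) +
            Algebra.trdeg ℚ ↥(IntermediateField.adjoin ℚ ({cexp c} : Set ℂ)) :=
          trdeg_adjoin_union_le S {cexp c}
      _ ≤ Algebra.trdeg ℚ ↥(IntermediateField.adjoin ℚ S) + 1 := add_le_add (le_refl _) hone
  have := (h1.trans (trdeg_le_of_injective (IntermediateField.inclusion hle)
    (IntermediateField.inclusion_injective hle))).trans key
  push_cast at this
  exact Cardinal.add_one_le_add_one_iff.mp this

/-- Antitonicity in the rank. [folklore] -/
theorem RoyThesisTyped.schanuelRank_anti {l l' : ℕ} (hll : l ≤ l') (h : SchanuelRank l') :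
    SchanuelRank l := by
  induction hll with
  | refl => exact h
  | step _ ih => exact ih (RoyThesisTyped.schanuelRank_of_succ h)

/-- **Roy's criterion is downward hereditary in the rank** (through Roy's equivalence, a kernel
theorem in tree). [cite: Roy2001, §5] -/
theorem RoyThesisTyped.royCriterion_anti {l l' : ℕ} (hll : l ≤ l') (h : RoyCriterion l') :
    RoyCriterion l :=
  (Roy2001_iff_holds l).mpr (RoyThesisTyped.schanuelRank_anti hll ((Roy2001_iff_holds l').mp h))

/-- **Counterexample ranks form an up-set**: a failure of Roy's criterion at rank `l` is a failure at
every rank `l' ≥ l`. [folklore] -/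
theorem RoyThesisTyped.not_royCriterion_of_le {l l' : ℕ} (hll : l ≤ l') (h : ¬ RoyCriterion l) :
    ¬ RoyCriterion l' :=
  fun h' => h (RoyThesisTyped.royCriterion_anti hll h')

/-- **The crux equals its own tail**: "Roy's criterion for infinitely many ranks" is NOT a weakening.
[folklore] -/
theorem RoyThesisTyped.crux_iff_frequently :
    Summit.Schanuel.Schanuel.Theses.RoyCriterion.RoyThesisTyped ↔ ∃ᶠ l in atTop, RoyCriterion l := by
  constructor
  · exact fun h => Frequently.of_forall h
  · intro h l
    obtain ⟨l', hl', h'⟩ := Filter.frequently_atTop.mp h l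
    exact RoyThesisTyped.royCriterion_anti hl' h'

/-- … and equals its eventual version. [folklore] -/
theorem RoyThesisTyped.crux_iff_eventually :
    Summit.Schanuel.Schanuel.Theses.RoyCriterion.RoyThesisTyped ↔ ∀ᶠ l in atTop, RoyCriterion l :=
  ⟨fun h => Eventually.of_forall h,
    fun h => RoyThesisTyped.crux_iff_frequently.mpr h.frequently⟩


/-- **Lindemann–Weierstrass layer** (tree theorem `algebraicIndependent_exp_holds`): Schanuel's
inequality holds for every `ℚ`-free tuple of ALGEBRAIC numbers, in every rank. [cite: BakerTNT1975, Ch. 1 Thm 1.4] -/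
theorem RoyThesisTyped.schanuelRank_of_isAlgebraic {l : ℕ} (y : Fin l → ℂ)
    (halg : ∀ j, IsAlgebraic ℚ (y j)) (hy : LinearIndependent ℚ y) :
    (l : Cardinal) ≤ Algebra.trdeg ℚ
      ↥(IntermediateField.adjoin ℚ (Set.range y ∪ Set.range (cexp ∘ y))) := by
  have hE : AlgebraicIndependent ℚ fun j => cexp (y j) := algebraicIndependent_exp_holds y halg hy
  set K := IntermediateField.adjoin ℚ (Set.range y ∪ Set.range (cexp ∘ y)) with hK
  let f : Fin l → K := fun j => ⟨cexp (y j), IntermediateField.subset_adjoin _ _ (Or.inr ⟨j, rfl⟩)⟩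
  have hf : AlgebraicIndependent ℚ f := AlgebraicIndependent.of_comp K.val hE
  simpa using hf.cardinalMk_le_trdeg

/-- **A counterexample has a transcendental coordinate** (contrapositive of the
Lindemann–Weierstrass layer): if `y` is `ℚ`-free with `trdeg ℚ(y, e^y) < l` then some `y j` is
transcendental. [cite: BakerTNT1975, Ch. 1 Thm 1.4] -/
theorem RoyThesisTyped.exists_transcendental_of_counterexample {l : ℕ} {y : Fin l → ℂ}
    (hy : LinearIndependent ℚ y)
    (hlt : Algebra.trdeg ℚ ↥(IntermediateField.adjoin ℚ (Set.range y ∪ Set.range (cexp ∘ y))) < l) :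
    ∃ j, Transcendental ℚ (y j) := by
  by_contra h
  have h' : ∀ j, IsAlgebraic ℚ (y j) := fun j => not_not.mp (not_exists.mp h j)
  exact (not_le.mpr hlt) (RoyThesisTyped.schanuelRank_of_isAlgebraic y h' hy)

/-- **At the first failing rank the defect is exactly one**: if Schanuel holds in rank `l` and
`y : Fin (l+1) → ℂ` is a `ℚ`-free counterexample in rank `l + 1`, then `trdeg ℚ(y, e^y) = l`
(the sub-tuple `y ∘ Fin.succ` already contributes `l`). [folklore] -/
theorem RoyThesisTyped.trdeg_eq_of_first_failure {l : ℕ} (hl : SchanuelRank l) {y : Fin (l + 1) → ℂ}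
    (hy : LinearIndependent ℚ y)
    (hlt : Algebra.trdeg ℚ ↥(IntermediateField.adjoin ℚ (Set.range y ∪ Set.range (cexp ∘ y))) <
      (l + 1 : ℕ)) :
    Algebra.trdeg ℚ ↥(IntermediateField.adjoin ℚ (Set.range y ∪ Set.range (cexp ∘ y))) = l := by
  have hsub : LinearIndependent ℚ (y ∘ Fin.succ) := hy.comp _ (Fin.succ_injective _)
  have h1 := hl (y ∘ Fin.succ) hsub
  have hle : IntermediateField.adjoin ℚ (Set.range (y ∘ Fin.succ) ∪ Set.range (cexp ∘ (y ∘ Fin.succ))) ≤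
      IntermediateField.adjoin ℚ (Set.range y ∪ Set.range (cexp ∘ y)) := by
    apply IntermediateField.adjoin.mono
    rintro x (⟨i, rfl⟩ | ⟨i, rfl⟩)
    · exact Or.inl ⟨i.succ, rfl⟩
    · exact Or.inr ⟨i.succ, rfl⟩
  have hge := h1.trans (trdeg_le_of_injective (IntermediateField.inclusion hle)
    (IntermediateField.inclusion_injective hle))
  refine le_antisymm ?_ hge
  have : Algebra.trdeg ℚ ↥(IntermediateField.adjoin ℚ (Set.range y ∪ Set.range (cexp ∘ y))) <
      Order.succ (l : Cardinal) := by
    rw [Cardinal.succ_natCast]; exact_mod_cast hlt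
  exact Order.lt_succ_iff.mp this


/-- **THE REDUCED CRUX**: the crux is equivalent to Schanuel's inequality for `ℚ`-free tuples of
rank `≥ 2`, drawn from the countable field `ecl ∅` (Kirby 2010 Prop. 7.2, tree theorem
`schanuelConjecture_iff_ecl_empty_holds`), with at least one transcendental coordinate
(Lindemann–Weierstrass layer); ranks `0, 1` hold in tree. [cite: Kirby2010, Prop. 7.2 and §1] -/
theorem RoyThesisTyped.crux_iff_reduced :
    Summit.Schanuel.Schanuel.Theses.RoyCriterion.RoyThesisTyped ↔
    ∀ (n : ℕ), 2 ≤ n → ∀ (x : Fin n → ℂ), (∀ i, x i ∈ ecl (∅ : Set ℂ)) →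
      (∃ i, Transcendental ℚ (x i)) → LinearIndependent ℚ x →
        (n : Cardinal) ≤ Algebra.trdeg ℚ
          ↥(IntermediateField.adjoin ℚ (Set.range x ∪ Set.range (Complex.exp ∘ x))) := by
  have hcs : Summit.Schanuel.Schanuel.Theses.RoyCriterion.RoyThesisTyped ↔ _root_.Schanuel :=
    ⟨fun h n => (Roy2001_iff_holds n).mp (h n), fun h n => (Roy2001_iff_holds n).mpr (h n)⟩
  rw [hcs.trans schanuelConjecture_iff_ecl_empty_holds]
  constructor
  · exact fun h n _ x hx _ hli => h n x hx hli
  · intro h n x hx hli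
    by_cases hn : n < 2
    · have hS : SchanuelRank n := by
        interval_cases n
        · exact schanuelRank_zero
        · exact Literature.Transcend.schanuelRank_one_of_transcendental_exp transcendental_exp_holds
      exact hS x hli
    · by_cases halg : ∀ i, IsAlgebraic ℚ (x i)
      · exact RoyThesisTyped.schanuelRank_of_isAlgebraic x halg hli
      · obtain ⟨i, hi⟩ := not_forall.mp halg
        exact h n (by omega) x hx ⟨i, hi⟩ hli

end Summit.Schanuel.Schanuel.Theorems

end
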